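import Literature.AlgebraicGeometry.Milne1999.LefschetzGroupFamilyStructure
import Literature.AlgebraicGeometry.Milne1999.LefschetzGroupCharacter
import Literature.AlgebraicGeometry.Milne1999.MumfordTateGroupPowersMulEquiv
import Literature.AlgebraicGeometry.HodgeTheory.WeightCocharacterHodgeGroupKernel
import HarnessLib

/-!
# `(L(X × Y), l) → (L(X), l) ×_{𝔾_m} (L(Y), l)` on the family carriers: the restriction homomorphism, its character,
# its image for Hom-orthogonal factors, and «torus coordinates with character multiply» (Milne 1999, Def. 4.6 / Cor. 4.7)

Family `hodge`, layer `Literature/AlgebraicGeometry/Milne1999`, namespace `Literature.AlgebraicGeometry.Milne1999`.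
THEOREMS ONLY (no definition, no named fact; D-0026 net debt 0).  Sequel of `Milne1999/LefschetzGroupOneProducts`
(`L(X × Y)(ℂ)|_{H¹} ∋ U ⟹ U = s ⊕ t`, `L(X × Y)|_{H¹} ≅ G(X) ×_{𝔾_m} G(Y)` on `H¹`, with CLASSES in the statement),
`Milne1999/LefschetzGroupFamilyStructure` (`L(X × Y)(ℂ) ≃* similitudeCentralizerGroupFibreProd …` as an ABSTRACT group) and
`Milne1999/LefschetzGroupCharacter` (the character `l` is the similitude multiplier, `ker l = S`, `l ∘ w = 2`).

Milne [Milne1999LefschetzClasses, Def. 4.6]: «Let `(Gᵢ, tᵢ)_{i ∈ I}` be a family of pairs […] We define `∏ (Gᵢ, tᵢ)` to be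
the pair `(G, t)` having as `G` the largest subgroup of `∏ Gᵢ` on which the characters `(gᵢ) ↦ tᵢ(gᵢ)` agree and having
as `t` their common restriction to `G`»; Cor. 4.7: «An isogeny `A → A₁^{r₁} × ⋯ × A_s^{r_s}` […] defines an isomorphism
`(L(A), l(A)) → ∏ᵢ (L(Aᵢ), l(Aᵢ))`»; p. 659: «`l ∘ w = -2`», «the kernel of `l(A)` […] equals `S(A)`».  This file puts the
binary case on the tree's FAMILY carriers `lefschetzGroup (dim Z) Z.X ≤ ∏ₖ GL(Hᵏ(Z(ℂ); ℂ))`, with the character read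
CLASS-FREE through `ker l` and `w` (`L = w(𝔾_m) · ker l`, `l(w(c)s) = c²`):

* §1 the character does not depend on the polarization (`polarizationPairingOne_eq_smul_iff_of_isPolarizationClass`: for
  `g ∈ L(Z)(ℂ)` the multiplier of `g₁` is the same for all polarization classes; on `X × Y` the product class
  `pr_X^* h_X + pr_Y^* h_Y` gives the same multiplier as any polarization class, `polarizationPairingOne_prod_eq_smul_iff`).
* §2 **THE RESTRICTION HOMOMORPHISM** (`dim X, dim Y ≥ 1`, NO hypothesis on `Hom`): there is a group homomorphism
  `ρ : L(X × Y)(ℂ) →* L(X)(ℂ) × L(Y)(ℂ)` with `g₁ = ρ(g)₁,₁ ⊕ ρ(g)₂,₁` (`exists_lefschetzGroup_prod_restrictHom`); ANY such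
  `ρ` is unique (`…_unique`), injective (`…_injective`, «`L(X × Y) ⊂ L(X) × L(Y)`»), has components the blocks of `g₁`
  (`…toLinearMap_eq_prodRestrictFst/Snd`), sends `w(c)` to `(w(c), w(c))` (`…_weightCocharacter`), satisfies
  `ρ(g)ᵢ ∈ ker l ⟺ g ∈ ker l` (`…_mem_specialLefschetzGroup_iff`), and PRESERVES THE CHARACTER: the multiplier of `g₁` for
  the product class / for any polarization class of `X × Y` is the multiplier of `ρ(g)₁,₁` for any polarization class of
  `X` (`…_polarizationPairingOne_eq_smul_iff`) — «`t` their common restriction».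
* §3 **`Hom(X, Y) = 0 = Hom(Y, X)`**: the image of `ρ` is Milne's fibre product, class-free —
  `(a, b) ∈ im ρ ⟺ ∃ c, s ∈ ker l(X), t ∈ ker l(Y), a = w(c)s ∧ b = w(c)t` (`mem_range_restrictHom_iff`), and `ρ` maps
  `ker l(X × Y)` ONTO `ker l(X) × ker l(Y)` (`exists_specialLefschetzGroup_restrictHom_eq`).
* §4 **TORUS COORDINATES WITH CHARACTER MULTIPLY** (`exists_lefschetzGroup_prod_mulEquiv_of_mulEquiv`): if
  `e_X : L(X)(ℂ) ≃* T_X × ℂˣ` and `e_Y : L(Y)(ℂ) ≃* T_Y × ℂˣ` have last coordinate the character (`= 1` on `ker l`,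
  `= c²` at `w(c)`), then `L(X × Y)(ℂ) ≃* (T_X × T_Y) × ℂˣ` with the same two properties and first coordinates read
  through `ρ` — the induction step for `(L, l)` of finite products (e.g. of CM abelian varieties,
  `Milne1999/LefschetzGroupCMProducts`, Milne 1999b Thm. 2.6 `(T^K, t^K) = ∏_Ψ (T^Ψ, t^Ψ)`).

## References

* [Milne1999LefschetzClasses] J. S. Milne, *Lefschetz classes on abelian varieties*, Duke Math. J. 96 (1999) 639–675: §1 p. 643
  (`C(A₁ × A₂) ⊂ C(A₁) × C(A₂)`), Prop. 1.5, §4 Def. 4.3, Thm. 4.4, Def. 4.6, Cor. 4.7, p. 659 (`l ∘ w = -2`, `ker l = S`).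
* [Milne1999] J. S. Milne, *Lefschetz motives and the Tate conjecture*, Compositio Math. 117 (1999): §1 Rem. 1.10, §2 Thm. 2.6.
* [MoonenZarhin1999LowDim] B. Moonen, Yu. G. Zarhin, Math. Ann. 315 (1999), §3 (3.1) (`Hg(X₁ × X₂) ⊂ Hg(X₁) × Hg(X₂)`).
-/

noncomputable section

open CategoryTheory
open Literature.AlgebraicTopology.SingularHomology
open Literature.AlgebraicGeometry.HodgeTheory
open Literature.AlgebraicGeometry.Motives

namespace Literature.AlgebraicGeometry.Milne1999

variable {X Y Z : AbelianVariety ℂ}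

/-! ### §0 Bookkeeping -/

section Bookkeeping

/-- `L(Z)(ℂ)|_{H¹} ≤ (C(Z) ⊗ ℂ)^×` (`dim Z ≥ 1`; `L|_{H¹} = G(Z)(h)` for a polarization class). [cite: Milne1999LefschetzClasses, Thm. 4.4 and §4 p. 659] -/
private theorem map_lefschetzGroup_one_le_centralizerGroup (hZ : 1 ≤ Z.dim) :
    (lefschetzGroup Z.dim Z.X).map (Pi.evalMonoidHom (fun k : ℕ ↦ complexBetti Z.X k ≃ₗ[ℂ] complexBetti Z.X k) 1) ≤
      centralizerGroup Z := by
  obtain ⟨h, hpol⟩ := exists_isPolarizationClass (AbelianVariety.isSmoothProjective_holds (A := Z))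
  rw [hpol.lefschetzGroup_map_one_eq hZ]
  exact similitudeCentralizerGroup_le_centralizerGroup

/-- `1 ≤ dim (X × Y)`. [folklore] -/
private theorem one_le_dim_prod (hX1 : 1 ≤ X.dim) : 1 ≤ (X.prod Y).dim := by
  rw [AbelianVariety.dim_prod]; omega

/-- `w(c)₁ = c · id`. [folklore] -/
private theorem weightCocharacter_one_eq (Z : AbelianVariety ℂ) (c : ℂˣ) :
    weightCocharacter Z.X c 1 = LinearEquiv.smulOfUnit c := by
  rw [show weightCocharacter Z.X c 1 = LinearEquiv.smulOfUnit (c ^ 1) from rfl, pow_one]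

/-- `s ⊕ t` determines `s` and `t`. [cite: Milne1999LefschetzClasses, §1 p. 643 (V(A₁ × A₂) = V(A₁) ⊕ V(A₂))] -/
private theorem prodBlockDiagEquiv_inj {s s' : complexBetti X.X 1 ≃ₗ[ℂ] complexBetti X.X 1}
    {t t' : complexBetti Y.X 1 ≃ₗ[ℂ] complexBetti Y.X 1} (h : prodBlockDiagEquiv s t = prodBlockDiagEquiv s' t') :
    s = s' ∧ t = t' := by
  have e := congrArg LinearEquiv.toLinearMap h
  rw [coe_prodBlockDiagEquiv, coe_prodBlockDiagEquiv] at e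
  refine ⟨LinearEquiv.toLinearMap_injective ?_, LinearEquiv.toLinearMap_injective ?_⟩
  · rw [← prodRestrictFst_prodBlockDiag s.toLinearMap t.toLinearMap, e, prodRestrictFst_prodBlockDiag]
  · rw [← prodRestrictSnd_prodBlockDiag s.toLinearMap t.toLinearMap, e, prodRestrictSnd_prodBlockDiag]

/-- **`l ∘ w = 2` through a unitary factor**: if `s₁` is `Q_h`-unitary then `(w(c)s)₁` multiplies `Q_h` by `c²`.
[cite: Milne1999LefschetzClasses, §4 p. 659 (l ∘ w = -2, ker l = S(A))] -/
private theorem polarizationPairingOne_weightCocharacter_mul (h : complexBetti Z.X 2) (c : ℂˣ)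
    {s : ∀ k : ℕ, complexBetti Z.X k ≃ₗ[ℂ] complexBetti Z.X k}
    (hs : ∀ x y : complexBetti Z.X 1,
      polarizationPairingOne Z.X h (Z.dim - 1) (s 1 x) (s 1 y) = polarizationPairingOne Z.X h (Z.dim - 1) x y)
    (x y : complexBetti Z.X 1) :
    polarizationPairingOne Z.X h (Z.dim - 1) ((weightCocharacter Z.X c * s) 1 x) ((weightCocharacter Z.X c * s) 1 y) =
      (((c ^ 2 : ℂˣ) : ℂ)) • polarizationPairingOne Z.X h (Z.dim - 1) x y := by
  rw [Pi.mul_apply, LinearEquiv.mul_apply, LinearEquiv.mul_apply, polarizationPairingOne_weightCocharacter_one, hs]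

/-- The product form `Q_D`, `D = pr_X^* h_X + pr_Y^* h_Y`, is not identically zero on `H¹(X × Y)` for polarization
classes `h_X`, `h_Y` (`dim X, dim Y ≥ 1`; non-degenerate, `H¹ ≠ 0`). [cite: Milne1999LefschetzClasses, §1 p. 643] -/
private theorem exists_polarizationPairingOne_prod_ne_zero (hX1 : 1 ≤ X.dim) (hY1 : 1 ≤ Y.dim)
    {hX : complexBetti X.X 2} {hY : complexBetti Y.X 2} (hpolX : IsPolarizationClass X.dim X.X hX)
    (hpolY : IsPolarizationClass Y.dim Y.X hY) :
    ∃ x y : complexBetti (X.prod Y).X 1,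
      polarizationPairingOne (X.prod Y).X (prodPolarizationClass X Y hX hY) ((X.prod Y).dim - 1) x y ≠ 0 := by
  haveI : Module.Finite ℂ (complexBetti (X.prod Y).X 1) := abelianVarietyCohomologyExteriorH1_holds.finite_one (X.prod Y)
  have hV : 0 < Module.finrank ℂ (complexBetti (X.prod Y).X 1) := by
    rw [AbelianVariety.finrank_complexBetti_one, AbelianVariety.dim_prod]; omega
  obtain ⟨x, hx⟩ := Module.finrank_pos_iff_exists_ne_zero.1 hV
  by_contra H
  refine hx (eq_zero_of_forall_polarizationPairingOne_prod_eq_zero hX hY hX1 hY1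
    (AbelianVariety.lefschetzPow_self_ne_zero_of_hasHardLefschetzProperty hX1 hpolX.hasHardLefschetz)
    (AbelianVariety.lefschetzPow_self_ne_zero_of_hasHardLefschetzProperty hY1 hpolY.hasHardLefschetz)
    (fun z hz ↦ eq_zero_of_forall_polarizationPairingOne_eq_zero_of_hasHardLefschetzProperty hX1 hpolX.hasHardLefschetz hz)
    (fun z hz ↦ eq_zero_of_forall_polarizationPairingOne_eq_zero_of_hasHardLefschetzProperty hY1 hpolY.hasHardLefschetz hz)
    x fun y ↦ ?_)
  by_contra hy
  exact H ⟨x, y, hy⟩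

end Bookkeeping

/-! ### §1 The character does not depend on the polarization; the product class gives the same character -/

section Character

/-- **The multiplier of `g ∈ L(Z)(ℂ)` on `H¹` is the same for all polarization classes** (`dim Z ≥ 1`): writing
`g = w(c₀)s`, `s ∈ ker l(Z)`, the multiplier is `c₀²` for every polarization class (`ker l = S(A)(h)` for each, Thm. 4.4;
`l ∘ w = 2`) — Milne's `l(g)` is intrinsic. [cite: Milne1999LefschetzClasses, Def. 4.3, Thm. 4.4 and §4 p. 659] -/
theorem polarizationPairingOne_eq_smul_iff_of_isPolarizationClass (hZ : 1 ≤ Z.dim) {h h' : complexBetti Z.X 2}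
    (hpol : IsPolarizationClass Z.dim Z.X h) (hpol' : IsPolarizationClass Z.dim Z.X h')
    {g : ∀ k : ℕ, complexBetti Z.X k ≃ₗ[ℂ] complexBetti Z.X k} (hg : g ∈ lefschetzGroup Z.dim Z.X) (c : ℂˣ) :
    (∀ x y : complexBetti Z.X 1, polarizationPairingOne Z.X h (Z.dim - 1) (g 1 x) (g 1 y) =
        (c : ℂ) • polarizationPairingOne Z.X h (Z.dim - 1) x y) ↔
      ∀ x y : complexBetti Z.X 1, polarizationPairingOne Z.X h' (Z.dim - 1) (g 1 x) (g 1 y) =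
        (c : ℂ) • polarizationPairingOne Z.X h' (Z.dim - 1) x y := by
  obtain ⟨c₀, s, hs, rfl⟩ := mem_lefschetzGroup_iff_exists_weightCocharacter_mul.1 hg
  have e := polarizationPairingOne_weightCocharacter_mul h c₀ ((hpol.mem_specialLefschetzGroup_iff_mem_lefschetzGroup hZ).1 hs).2
  have e' := polarizationPairingOne_weightCocharacter_mul h' c₀
    ((hpol'.mem_specialLefschetzGroup_iff_mem_lefschetzGroup hZ).1 hs).2
  constructor
  · intro hc
    obtain rfl : c = c₀ ^ 2 := multiplier_unique hc e (hpol.exists_polarizationPairingOne_ne_zero hZ)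
    exact e'
  · intro hc
    obtain rfl : c = c₀ ^ 2 := multiplier_unique hc e' (hpol'.exists_polarizationPairingOne_ne_zero hZ)
    exact e

/-- **On `X × Y` the product class `D = pr_X^* h_X + pr_Y^* h_Y` of two polarization classes gives the same multiplier as
any polarization class `h` of `X × Y`** (`g ∈ L(X × Y)(ℂ)`; `ker l(X × Y)|_{H¹} = S(X × Y)(D)(ℂ)`, Thm. 4.4 for `D` — the
class `D` of Milne's «`D = Σᵢ A₁ × ⋯ × Dᵢ × ⋯ × A_s` is an ample divisor on `A`» need not be known to be a polarization class
of the tree). [cite: Milne1999LefschetzClasses, §1 p. 643, Thm. 4.4 and p. 659] -/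
theorem polarizationPairingOne_prod_eq_smul_iff (hX1 : 1 ≤ X.dim) (hY1 : 1 ≤ Y.dim) {hX : complexBetti X.X 2}
    {hY : complexBetti Y.X 2} (hpolX : IsPolarizationClass X.dim X.X hX) (hpolY : IsPolarizationClass Y.dim Y.X hY)
    {h : complexBetti (X.prod Y).X 2} (hpol : IsPolarizationClass (X.prod Y).dim (X.prod Y).X h)
    {g : ∀ k : ℕ, complexBetti (X.prod Y).X k ≃ₗ[ℂ] complexBetti (X.prod Y).X k}
    (hg : g ∈ lefschetzGroup (X.prod Y).dim (X.prod Y).X) (c : ℂˣ) :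
    (∀ x y : complexBetti (X.prod Y).X 1,
        polarizationPairingOne (X.prod Y).X (prodPolarizationClass X Y hX hY) ((X.prod Y).dim - 1) (g 1 x) (g 1 y) =
          (c : ℂ) • polarizationPairingOne (X.prod Y).X (prodPolarizationClass X Y hX hY) ((X.prod Y).dim - 1) x y) ↔
      ∀ x y : complexBetti (X.prod Y).X 1, polarizationPairingOne (X.prod Y).X h ((X.prod Y).dim - 1) (g 1 x) (g 1 y) =
        (c : ℂ) • polarizationPairingOne (X.prod Y).X h ((X.prod Y).dim - 1) x y := by
  have hXY := one_le_dim_prod (Y := Y) hX1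
  obtain ⟨c₀, s, hs, rfl⟩ := mem_lefschetzGroup_iff_exists_weightCocharacter_mul.1 hg
  have hsD : s 1 ∈ unitaryCentralizerGroup (X.prod Y) (prodPolarizationClass X Y hX hY) :=
    (specialLefschetzGroup_map_one_prod_eq_unitaryCentralizerGroup_of_isPolarizationClass hpolX hpolY hX1 hY1).le
      ⟨s, hs, rfl⟩
  have e := polarizationPairingOne_weightCocharacter_mul (prodPolarizationClass X Y hX hY) c₀ hsD.2
  have e' := polarizationPairingOne_weightCocharacter_mul h c₀ ((hpol.mem_specialLefschetzGroup_iff_mem_lefschetzGroup hXY).1 hs).2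
  constructor
  · intro hc
    obtain rfl : c = c₀ ^ 2 := multiplier_unique hc e (exists_polarizationPairingOne_prod_ne_zero hX1 hY1 hpolX hpolY)
    exact e'
  · intro hc
    obtain rfl : c = c₀ ^ 2 := multiplier_unique hc e' (hpol.exists_polarizationPairingOne_ne_zero hXY)
    exact e

end Character

/-! ### §2 The restriction homomorphism `ρ : L(X × Y)(ℂ) →* L(X)(ℂ) × L(Y)(ℂ)`, `g₁ = ρ(g)₁,₁ ⊕ ρ(g)₂,₁` -/

section Restrict

/-- **Existence of the restriction homomorphism** (`dim X, dim Y ≥ 1`, NO hypothesis on `Hom`): a group homomorphism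
`ρ : L(X × Y)(ℂ) →* L(X)(ℂ) × L(Y)(ℂ)` with `g₁ = ρ(g)₁,₁ ⊕ ρ(g)₂,₁` on `H¹(X × Y) = pr_X^* H¹(X) ⊕ pr_Y^* H¹(Y)` — the
family lift of «`C(A₁ × A₂) ⊂ C(A₁) × C(A₂)`» / «`L(X₁ × X₂) ⊂ L(X₁) × L(X₂)`»: `g₁ ∈ L(X × Y)|_{H¹}` is block diagonal with
blocks in `L(X)|_{H¹}`, `L(Y)|_{H¹}` (`exists_eq_prodBlockDiagEquiv_of_mem_map_lefschetzGroup_one_prod`), and an element of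
`L` is determined by its `H¹`-component (`lefschetzGroup_ext_one'`). [cite: Milne1999LefschetzClasses, §1 p. 643, Cor. 4.7 (p. 660)]
[cite: MoonenZarhin1999LowDim, §3 (3.1)] -/
theorem exists_lefschetzGroup_prod_restrictHom (hX1 : 1 ≤ X.dim) (hY1 : 1 ≤ Y.dim) :
    ∃ ρ : lefschetzGroup (X.prod Y).dim (X.prod Y).X →* lefschetzGroup X.dim X.X × lefschetzGroup Y.dim Y.X,
      ∀ g : lefschetzGroup (X.prod Y).dim (X.prod Y).X, g.1 1 = prodBlockDiagEquiv ((ρ g).1.1 1) ((ρ g).2.1 1) := by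
  classical
  have hXY := one_le_dim_prod (Y := Y) hX1
  -- `g ↦ g₁ ∈ C(X × Y)`, then the two blocks
  let ι : lefschetzGroup (X.prod Y).dim (X.prod Y).X →* centralizerGroup (X.prod Y) :=
    (Subgroup.inclusion (map_lefschetzGroup_one_le_centralizerGroup hXY)).comp
      ((Pi.evalMonoidHom (fun k : ℕ ↦ complexBetti (X.prod Y).X k ≃ₗ[ℂ] complexBetti (X.prod Y).X k) 1).subgroupMap
        (lefschetzGroup (X.prod Y).dim (X.prod Y).X))
  have hι : ∀ g : lefschetzGroup (X.prod Y).dim (X.prod Y).X,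
      ((ι g : centralizerGroup (X.prod Y)) : complexBetti (X.prod Y).X 1 ≃ₗ[ℂ] complexBetti (X.prod Y).X 1) = g.1 1 :=
    fun _ ↦ rfl
  let rX : lefschetzGroup (X.prod Y).dim (X.prod Y).X →* (complexBetti X.X 1 ≃ₗ[ℂ] complexBetti X.X 1) :=
    (centralizerGroup.restrictFstHom X Y).comp ι
  let rY : lefschetzGroup (X.prod Y).dim (X.prod Y).X →* (complexBetti Y.X 1 ≃ₗ[ℂ] complexBetti Y.X 1) :=
    (centralizerGroup.restrictSndHom X Y).comp ι
  have hblock : ∀ g : lefschetzGroup (X.prod Y).dim (X.prod Y).X,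
      rX g ∈ (lefschetzGroup X.dim X.X).map (Pi.evalMonoidHom (fun k : ℕ ↦ complexBetti X.X k ≃ₗ[ℂ] complexBetti X.X k) 1) ∧
      rY g ∈ (lefschetzGroup Y.dim Y.X).map (Pi.evalMonoidHom (fun k : ℕ ↦ complexBetti Y.X k ≃ₗ[ℂ] complexBetti Y.X k) 1) ∧
      g.1 1 = prodBlockDiagEquiv (rX g) (rY g) := fun g ↦ by
    obtain ⟨s, hs, t, ht, hst⟩ :=
      exists_eq_prodBlockDiagEquiv_of_mem_map_lefschetzGroup_one_prod X Y hX1 hY1 ⟨g.1, g.2, rfl⟩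
    have hst' : prodBlockDiagEquiv s t = g.1 1 := hst
    have hmem : prodBlockDiagEquiv s t ∈ centralizerGroup (X.prod Y) := by rw [hst']; exact (ι g).2
    have hιg : ι g = ⟨prodBlockDiagEquiv s t, hmem⟩ := Subtype.ext (by rw [hι]; exact hst'.symm)
    have e1 : rX g = s := by
      show centralizerGroup.restrictFstHom X Y (ι g) = s
      rw [hιg, centralizerGroup.restrictFstHom_prodBlockDiagEquiv]
    have e2 : rY g = t := by
      show centralizerGroup.restrictSndHom X Y (ι g) = t
      rw [hιg, centralizerGroup.restrictSndHom_prodBlockDiagEquiv]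
    rw [e1, e2]
    exact ⟨hs, ht, hst'.symm⟩
  -- lift the blocks to the families (`L(Z) ≅ L(Z)|_{H¹}`)
  let LX := MulEquiv.ofBijective _ (bijective_evalOne_subgroupMap_lefschetzGroup' X)
  let LY := MulEquiv.ofBijective _ (bijective_evalOne_subgroupMap_lefschetzGroup' Y)
  let ρX : lefschetzGroup (X.prod Y).dim (X.prod Y).X →* lefschetzGroup X.dim X.X :=
    LX.symm.toMonoidHom.comp (rX.codRestrict _ fun g ↦ (hblock g).1)
  let ρY : lefschetzGroup (X.prod Y).dim (X.prod Y).X →* lefschetzGroup Y.dim Y.X :=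
    LY.symm.toMonoidHom.comp (rY.codRestrict _ fun g ↦ (hblock g).2.1)
  have kX : ∀ g, (ρX g).1 1 = rX g := fun g ↦
    congrArg Subtype.val (LX.apply_symm_apply ⟨rX g, (hblock g).1⟩)
  have kY : ∀ g, (ρY g).1 1 = rY g := fun g ↦
    congrArg Subtype.val (LY.apply_symm_apply ⟨rY g, (hblock g).2.1⟩)
  refine ⟨ρX.prod ρY, fun g ↦ ?_⟩
  show g.1 1 = prodBlockDiagEquiv ((ρX g).1 1) ((ρY g).1 1)
  rw [kX, kY]
  exact (hblock g).2.2

variable {ρ ρ' : lefschetzGroup (X.prod Y).dim (X.prod Y).X →* lefschetzGroup X.dim X.X × lefschetzGroup Y.dim Y.X}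

/-- **Uniqueness**: a homomorphism `ρ` with `g₁ = ρ(g)₁,₁ ⊕ ρ(g)₂,₁` is unique (blocks are determined by the block-diagonal
map; elements of `L` by their `H¹`-components). [cite: Milne1999LefschetzClasses, §1 p. 643 and Def. 4.3] -/
theorem lefschetzGroup_prod_restrictHom_unique
    (hρ : ∀ g : lefschetzGroup (X.prod Y).dim (X.prod Y).X, g.1 1 = prodBlockDiagEquiv ((ρ g).1.1 1) ((ρ g).2.1 1))
    (hρ' : ∀ g : lefschetzGroup (X.prod Y).dim (X.prod Y).X, g.1 1 = prodBlockDiagEquiv ((ρ' g).1.1 1) ((ρ' g).2.1 1)) :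
    ρ = ρ' := by
  refine MonoidHom.ext fun g ↦ ?_
  obtain ⟨e1, e2⟩ := prodBlockDiagEquiv_inj ((hρ g).symm.trans (hρ' g))
  exact Prod.ext (Subtype.ext (lefschetzGroup_ext_one' (ρ g).1.2 (ρ' g).1.2 e1))
    (Subtype.ext (lefschetzGroup_ext_one' (ρ g).2.2 (ρ' g).2.2 e2))

/-- **`L(X × Y) ⊂ L(X) × L(Y)`: the restriction homomorphism is injective.** [cite: Milne1999LefschetzClasses, §1 p. 643 and Cor. 4.7]
[cite: MoonenZarhin1999LowDim, §3 (3.1)] -/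
theorem lefschetzGroup_prod_restrictHom_injective
    (hρ : ∀ g : lefschetzGroup (X.prod Y).dim (X.prod Y).X, g.1 1 = prodBlockDiagEquiv ((ρ g).1.1 1) ((ρ g).2.1 1)) :
    Function.Injective ρ := fun g g' h ↦ by
  refine Subtype.ext (lefschetzGroup_ext_one' g.2 g'.2 ?_)
  rw [hρ g, hρ g', h]

/-- The first component of `ρ(g)` on `H¹` is the `X`-block of `g₁`: `(ρ(g)₁,₁) = (𝟙, 0)^* ∘ g₁ ∘ pr_X^*`.
[cite: Milne1999LefschetzClasses, §1 p. 643] -/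
theorem lefschetzGroup_prod_restrictHom_fst_toLinearMap
    (hρ : ∀ g : lefschetzGroup (X.prod Y).dim (X.prod Y).X, g.1 1 = prodBlockDiagEquiv ((ρ g).1.1 1) ((ρ g).2.1 1))
    (g : lefschetzGroup (X.prod Y).dim (X.prod Y).X) :
    ((ρ g).1.1 1).toLinearMap = prodRestrictFst (g.1 1).toLinearMap := by
  rw [hρ g, coe_prodBlockDiagEquiv, prodRestrictFst_prodBlockDiag]

/-- The second component of `ρ(g)` on `H¹` is the `Y`-block of `g₁`: `(ρ(g)₂,₁) = (0, 𝟙)^* ∘ g₁ ∘ pr_Y^*`.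
[cite: Milne1999LefschetzClasses, §1 p. 643] -/
theorem lefschetzGroup_prod_restrictHom_snd_toLinearMap
    (hρ : ∀ g : lefschetzGroup (X.prod Y).dim (X.prod Y).X, g.1 1 = prodBlockDiagEquiv ((ρ g).1.1 1) ((ρ g).2.1 1))
    (g : lefschetzGroup (X.prod Y).dim (X.prod Y).X) :
    ((ρ g).2.1 1).toLinearMap = prodRestrictSnd (g.1 1).toLinearMap := by
  rw [hρ g, coe_prodBlockDiagEquiv, prodRestrictSnd_prodBlockDiag]

/-- **`ρ(w(c)) = (w(c), w(c))`**: the weight cocharacter of `X × Y` restricts to those of the factors (`c · id = c · id ⊕ c · id`).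
[cite: Milne1999LefschetzClasses, §4 p. 659 (the cocharacter w)] -/
theorem lefschetzGroup_prod_restrictHom_weightCocharacter
    (hρ : ∀ g : lefschetzGroup (X.prod Y).dim (X.prod Y).X, g.1 1 = prodBlockDiagEquiv ((ρ g).1.1 1) ((ρ g).2.1 1))
    (c : ℂˣ) :
    ρ ⟨weightCocharacter (X.prod Y).X c, weightCocharacter_mem_lefschetzGroup c⟩ =
      (⟨weightCocharacter X.X c, weightCocharacter_mem_lefschetzGroup c⟩,
        ⟨weightCocharacter Y.X c, weightCocharacter_mem_lefschetzGroup c⟩) := by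
  have key : weightCocharacter (X.prod Y).X c 1 =
      prodBlockDiagEquiv ((ρ ⟨weightCocharacter (X.prod Y).X c, weightCocharacter_mem_lefschetzGroup c⟩).1.1 1)
        ((ρ ⟨weightCocharacter (X.prod Y).X c, weightCocharacter_mem_lefschetzGroup c⟩).2.1 1) :=
    hρ ⟨weightCocharacter (X.prod Y).X c, weightCocharacter_mem_lefschetzGroup c⟩
  rw [weightCocharacter_one_eq (X.prod Y) c, ← prodBlockDiagEquiv_smulOfUnit X Y c] at key
  obtain ⟨e1, e2⟩ := prodBlockDiagEquiv_inj key
  refine Prod.ext (Subtype.ext (lefschetzGroup_ext_one' (ρ _).1.2 (weightCocharacter_mem_lefschetzGroup c) ?_))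
    (Subtype.ext (lefschetzGroup_ext_one' (ρ _).2.2 (weightCocharacter_mem_lefschetzGroup c) ?_))
  · rw [← e1]
    exact (weightCocharacter_one_eq X c).symm
  · rw [← e2]
    exact (weightCocharacter_one_eq Y c).symm

/-- **The character is preserved, product class**: if `g₁` multiplies `Q_D` (`D = pr_X^* h_X + pr_Y^* h_Y`, polarization
classes) by `c`, then `ρ(g)₁,₁` multiplies `Q_{h_X}` by `c` and `ρ(g)₂,₁` multiplies `Q_{h_Y}` by `c` — «having as `t` their
common restriction». [cite: Milne1999LefschetzClasses, Def. 4.6 and Cor. 4.7 (p. 660), §1 p. 643] -/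
theorem lefschetzGroup_prod_restrictHom_polarizationPairingOne_eq_smul
    (hρ : ∀ g : lefschetzGroup (X.prod Y).dim (X.prod Y).X, g.1 1 = prodBlockDiagEquiv ((ρ g).1.1 1) ((ρ g).2.1 1))
    (hX1 : 1 ≤ X.dim) (hY1 : 1 ≤ Y.dim) {hX : complexBetti X.X 2} {hY : complexBetti Y.X 2}
    (hpolX : IsPolarizationClass X.dim X.X hX) (hpolY : IsPolarizationClass Y.dim Y.X hY)
    (g : lefschetzGroup (X.prod Y).dim (X.prod Y).X) {c : ℂ}
    (hc : ∀ x y : complexBetti (X.prod Y).X 1,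
      polarizationPairingOne (X.prod Y).X (prodPolarizationClass X Y hX hY) ((X.prod Y).dim - 1) (g.1 1 x) (g.1 1 y) =
        c • polarizationPairingOne (X.prod Y).X (prodPolarizationClass X Y hX hY) ((X.prod Y).dim - 1) x y) :
    (∀ a a' : complexBetti X.X 1, polarizationPairingOne X.X hX (X.dim - 1) ((ρ g).1.1 1 a) ((ρ g).1.1 1 a') =
        c • polarizationPairingOne X.X hX (X.dim - 1) a a') ∧
      ∀ b b' : complexBetti Y.X 1, polarizationPairingOne Y.X hY (Y.dim - 1) ((ρ g).2.1 1 b) ((ρ g).2.1 1 b') =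
        c • polarizationPairingOne Y.X hY (Y.dim - 1) b b' := by
  have hmem : g.1 1 ∈ centralizerGroup (X.prod Y) :=
    map_lefschetzGroup_one_le_centralizerGroup (one_le_dim_prod (Y := Y) hX1) ⟨g.1, g.2, rfl⟩
  have eX : ∀ a, (ρ g).1.1 1 a = prodRestrictFst (g.1 1).toLinearMap a := fun a ↦ by
    rw [← lefschetzGroup_prod_restrictHom_fst_toLinearMap hρ g]; rfl
  have eY : ∀ b, (ρ g).2.1 1 b = prodRestrictSnd (g.1 1).toLinearMap b := fun b ↦ by
    rw [← lefschetzGroup_prod_restrictHom_snd_toLinearMap hρ g]; rfl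
  refine ⟨fun a a' ↦ ?_, fun b b' ↦ ?_⟩
  · rw [eX, eX]
    exact polarizationPairingOne_prodRestrictFst_eq_smul hX hY
      (AbelianVariety.lefschetzPow_self_ne_zero_of_hasHardLefschetzProperty hY1 hpolY.hasHardLefschetz) hmem c hc a a'
  · rw [eY, eY]
    exact polarizationPairingOne_prodRestrictSnd_eq_smul hX hY
      (AbelianVariety.lefschetzPow_self_ne_zero_of_hasHardLefschetzProperty hX1 hpolX.hasHardLefschetz) hmem c hc b b'

/-- **`g ∈ ker l(X × Y) ⟹ ρ(g) ∈ ker l(X) × ker l(Y)`** (`ker l = S`: `g₁` is `Q_D`-unitary, hence so are its blocks).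
[cite: Milne1999LefschetzClasses, Prop. 1.5, Thm. 4.4 and p. 659 (ker l = S(A))] -/
theorem lefschetzGroup_prod_restrictHom_mem_specialLefschetzGroup
    (hρ : ∀ g : lefschetzGroup (X.prod Y).dim (X.prod Y).X, g.1 1 = prodBlockDiagEquiv ((ρ g).1.1 1) ((ρ g).2.1 1))
    (hX1 : 1 ≤ X.dim) (hY1 : 1 ≤ Y.dim) {g : lefschetzGroup (X.prod Y).dim (X.prod Y).X}
    (hg : g.1 ∈ specialLefschetzGroup (X.prod Y).dim (X.prod Y).X) :
    (ρ g).1.1 ∈ specialLefschetzGroup X.dim X.X ∧ (ρ g).2.1 ∈ specialLefschetzGroup Y.dim Y.X := by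
  obtain ⟨hX, hpolX⟩ := exists_isPolarizationClass (AbelianVariety.isSmoothProjective_holds (A := X))
  obtain ⟨hY, hpolY⟩ := exists_isPolarizationClass (AbelianVariety.isSmoothProjective_holds (A := Y))
  have hsD : g.1 1 ∈ unitaryCentralizerGroup (X.prod Y) (prodPolarizationClass X Y hX hY) :=
    (specialLefschetzGroup_map_one_prod_eq_unitaryCentralizerGroup_of_isPolarizationClass hpolX hpolY hX1 hY1).le
      ⟨g.1, hg, rfl⟩
  have h1 := lefschetzGroup_prod_restrictHom_polarizationPairingOne_eq_smul hρ hX1 hY1 hpolX hpolY g (c := 1)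
    (fun x y ↦ by rw [one_smul]; exact hsD.2 x y)
  exact ⟨(hpolX.mem_specialLefschetzGroup_iff_mem_lefschetzGroup hX1).2 ⟨(ρ g).1.2, fun x y ↦ by rw [h1.1, one_smul]⟩,
    (hpolY.mem_specialLefschetzGroup_iff_mem_lefschetzGroup hY1).2 ⟨(ρ g).2.2, fun x y ↦ by rw [h1.2, one_smul]⟩⟩

/-- **`ρ(g)₁ ∈ ker l(X) ⟺ g ∈ ker l(X × Y)`** — the character of `g` is that of its first component: writing `g = w(c)s`,
`ρ(g)₁ = w(c) ρ(s)₁` with `ρ(s)₁ ∈ ker l(X)`, and `w(c) ∈ ker l ⟺ c² = 1` on `X` as on `X × Y`.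
[cite: Milne1999LefschetzClasses, Def. 4.6, Cor. 4.7 and p. 659 (l ∘ w = -2, ker l = S(A))] -/
theorem lefschetzGroup_prod_restrictHom_fst_mem_specialLefschetzGroup_iff
    (hρ : ∀ g : lefschetzGroup (X.prod Y).dim (X.prod Y).X, g.1 1 = prodBlockDiagEquiv ((ρ g).1.1 1) ((ρ g).2.1 1))
    (hX1 : 1 ≤ X.dim) (hY1 : 1 ≤ Y.dim) (g : lefschetzGroup (X.prod Y).dim (X.prod Y).X) :
    (ρ g).1.1 ∈ specialLefschetzGroup X.dim X.X ↔ g.1 ∈ specialLefschetzGroup (X.prod Y).dim (X.prod Y).X := by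
  refine ⟨fun h ↦ ?_, fun h ↦ (lefschetzGroup_prod_restrictHom_mem_specialLefschetzGroup hρ hX1 hY1 h).1⟩
  obtain ⟨c, s, hs, hgs⟩ := mem_lefschetzGroup_iff_exists_weightCocharacter_mul.1 g.2
  have hg : g = ⟨weightCocharacter (X.prod Y).X c, weightCocharacter_mem_lefschetzGroup c⟩ *
      ⟨s, specialLefschetzGroup_le_lefschetzGroup hs⟩ := Subtype.ext hgs
  have hρs := (lefschetzGroup_prod_restrictHom_mem_specialLefschetzGroup hρ hX1 hY1
    (g := ⟨s, specialLefschetzGroup_le_lefschetzGroup hs⟩) hs).1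
  rw [hg, map_mul, lefschetzGroup_prod_restrictHom_weightCocharacter hρ, Prod.fst_mul, Subgroup.coe_mul] at h
  -- `w_X(c) ∈ ker l(X)`, so `c² = 1`, so `w_{X×Y}(c) ∈ ker l(X × Y)`
  have hw : weightCocharacter X.X c ∈ specialLefschetzGroup X.dim X.X := by
    have := (specialLefschetzGroup X.dim X.X).mul_mem h ((specialLefschetzGroup X.dim X.X).inv_mem hρs)
    rwa [mul_inv_cancel_right] at this
  have hc : (c : ℂ) ^ 2 = 1 :=
    (weightCocharacter_mem_specialLefschetzGroup_iff (AbelianVariety.isSmoothProjective_holds (A := X)) hX1).1 hw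
  rw [hgs]
  exact (specialLefschetzGroup _ _).mul_mem
    ((weightCocharacter_mem_specialLefschetzGroup_iff (AbelianVariety.isSmoothProjective_holds (A := X.prod Y))
      (one_le_dim_prod (Y := Y) hX1)).2 hc) hs

/-- **`ρ(g)₂ ∈ ker l(Y) ⟺ g ∈ ker l(X × Y)`.** [cite: Milne1999LefschetzClasses, Def. 4.6, Cor. 4.7 and p. 659] -/
theorem lefschetzGroup_prod_restrictHom_snd_mem_specialLefschetzGroup_iff
    (hρ : ∀ g : lefschetzGroup (X.prod Y).dim (X.prod Y).X, g.1 1 = prodBlockDiagEquiv ((ρ g).1.1 1) ((ρ g).2.1 1))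
    (hX1 : 1 ≤ X.dim) (hY1 : 1 ≤ Y.dim) (g : lefschetzGroup (X.prod Y).dim (X.prod Y).X) :
    (ρ g).2.1 ∈ specialLefschetzGroup Y.dim Y.X ↔ g.1 ∈ specialLefschetzGroup (X.prod Y).dim (X.prod Y).X := by
  refine ⟨fun h ↦ ?_, fun h ↦ (lefschetzGroup_prod_restrictHom_mem_specialLefschetzGroup hρ hX1 hY1 h).2⟩
  obtain ⟨c, s, hs, hgs⟩ := mem_lefschetzGroup_iff_exists_weightCocharacter_mul.1 g.2
  have hg : g = ⟨weightCocharacter (X.prod Y).X c, weightCocharacter_mem_lefschetzGroup c⟩ *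
      ⟨s, specialLefschetzGroup_le_lefschetzGroup hs⟩ := Subtype.ext hgs
  have hρs := (lefschetzGroup_prod_restrictHom_mem_specialLefschetzGroup hρ hX1 hY1
    (g := ⟨s, specialLefschetzGroup_le_lefschetzGroup hs⟩) hs).2
  rw [hg, map_mul, lefschetzGroup_prod_restrictHom_weightCocharacter hρ, Prod.snd_mul, Subgroup.coe_mul] at h
  have hw : weightCocharacter Y.X c ∈ specialLefschetzGroup Y.dim Y.X := by
    have := (specialLefschetzGroup Y.dim Y.X).mul_mem h ((specialLefschetzGroup Y.dim Y.X).inv_mem hρs)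
    rwa [mul_inv_cancel_right] at this
  have hc : (c : ℂ) ^ 2 = 1 :=
    (weightCocharacter_mem_specialLefschetzGroup_iff (AbelianVariety.isSmoothProjective_holds (A := Y)) hY1).1 hw
  rw [hgs]
  exact (specialLefschetzGroup _ _).mul_mem
    ((weightCocharacter_mem_specialLefschetzGroup_iff (AbelianVariety.isSmoothProjective_holds (A := X.prod Y))
      (one_le_dim_prod (Y := Y) hX1)).2 hc) hs

/-- **The character is preserved, polarization classes** (`h` any polarization class of `X × Y`, `h_X` any of `X`):
`g₁` multiplies `Q_h` by `c` iff `ρ(g)₁,₁` multiplies `Q_{h_X}` by `c` — `l_{X × Y}(g) = l_X(ρ(g)₁)`.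
[cite: Milne1999LefschetzClasses, Def. 4.6 and Cor. 4.7 (p. 660)] -/
theorem lefschetzGroup_prod_restrictHom_polarizationPairingOne_eq_smul_iff
    (hρ : ∀ g : lefschetzGroup (X.prod Y).dim (X.prod Y).X, g.1 1 = prodBlockDiagEquiv ((ρ g).1.1 1) ((ρ g).2.1 1))
    (hX1 : 1 ≤ X.dim) (hY1 : 1 ≤ Y.dim) {h : complexBetti (X.prod Y).X 2} {hX : complexBetti X.X 2}
    (hpol : IsPolarizationClass (X.prod Y).dim (X.prod Y).X h) (hpolX : IsPolarizationClass X.dim X.X hX)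
    (g : lefschetzGroup (X.prod Y).dim (X.prod Y).X) (c : ℂˣ) :
    (∀ x y : complexBetti (X.prod Y).X 1, polarizationPairingOne (X.prod Y).X h ((X.prod Y).dim - 1) (g.1 1 x) (g.1 1 y) =
        (c : ℂ) • polarizationPairingOne (X.prod Y).X h ((X.prod Y).dim - 1) x y) ↔
      ∀ a a' : complexBetti X.X 1, polarizationPairingOne X.X hX (X.dim - 1) ((ρ g).1.1 1 a) ((ρ g).1.1 1 a') =
        (c : ℂ) • polarizationPairingOne X.X hX (X.dim - 1) a a' := by
  obtain ⟨hY, hpolY⟩ := exists_isPolarizationClass (AbelianVariety.isSmoothProjective_holds (A := Y))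
  have hXY := one_le_dim_prod (Y := Y) hX1
  constructor
  · intro hc
    exact (lefschetzGroup_prod_restrictHom_polarizationPairingOne_eq_smul hρ hX1 hY1 hpolX hpolY g
      ((polarizationPairingOne_prod_eq_smul_iff hX1 hY1 hpolX hpolY hpol g.2 c).2 hc)).1
  · intro hc
    -- `g = w(c₀)s`, `ρ(g)₁ = w(c₀) ρ(s)₁` has multiplier `c₀²` on `X`, so `c = c₀²`, the multiplier of `g` on `X × Y`
    obtain ⟨c₀, s, hs, hgs⟩ := mem_lefschetzGroup_iff_exists_weightCocharacter_mul.1 g.2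
    have hg : g = ⟨weightCocharacter (X.prod Y).X c₀, weightCocharacter_mem_lefschetzGroup c₀⟩ *
        ⟨s, specialLefschetzGroup_le_lefschetzGroup hs⟩ := Subtype.ext hgs
    have hρs := (lefschetzGroup_prod_restrictHom_mem_specialLefschetzGroup hρ hX1 hY1
      (g := ⟨s, specialLefschetzGroup_le_lefschetzGroup hs⟩) hs).1
    have e1 : (ρ g).1.1 = weightCocharacter X.X c₀ * (ρ ⟨s, specialLefschetzGroup_le_lefschetzGroup hs⟩).1.1 := by
      rw [hg, map_mul, lefschetzGroup_prod_restrictHom_weightCocharacter hρ, Prod.fst_mul, Subgroup.coe_mul]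
    have eX := polarizationPairingOne_weightCocharacter_mul hX c₀
      ((hpolX.mem_specialLefschetzGroup_iff_mem_lefschetzGroup hX1).1 hρs).2
    rw [← e1] at eX
    obtain rfl : c = c₀ ^ 2 := multiplier_unique hc eX (hpolX.exists_polarizationPairingOne_ne_zero hX1)
    have e := polarizationPairingOne_weightCocharacter_mul h c₀ ((hpol.mem_specialLefschetzGroup_iff_mem_lefschetzGroup hXY).1 hs).2
    rw [← hgs] at e
    exact e

end Restrict

/-! ### §3 Hom-orthogonal factors: the image of `ρ` is the fibre product `{(w(c)s, w(c)t)}`; `ker l(X × Y) ↠ ker l(X) × ker l(Y)` -/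

section HomOrthogonal

variable {ρ : lefschetzGroup (X.prod Y).dim (X.prod Y).X →* lefschetzGroup X.dim X.X × lefschetzGroup Y.dim Y.X}

/-- **`ρ` maps `ker l(X × Y)` ONTO `ker l(X) × ker l(Y)`** for `Hom(X, Y) = 0 = Hom(Y, X)`: every pair `(s, t)` of elements of
the special Lefschetz groups of the factors is `ρ(g)` for a (unique) `g ∈ ker l(X × Y)` — `s₁ ⊕ t₁ ∈ S(X × Y)(D) = ker l(X × Y)|_{H¹}`
(Prop. 1.5 «`S(A₁) × ⋯ × S(A_s) → S(A)` is an isomorphism», binary, family level). [cite: Milne1999LefschetzClasses, Prop. 1.5 (p. 644) and Thm. 4.4] -/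
theorem exists_specialLefschetzGroup_restrictHom_eq
    (hρ : ∀ g : lefschetzGroup (X.prod Y).dim (X.prod Y).X, g.1 1 = prodBlockDiagEquiv ((ρ g).1.1 1) ((ρ g).2.1 1))
    (hXY : ∀ f : X ⟶ Y, f = 0) (hYX : ∀ f : Y ⟶ X, f = 0) (hX1 : 1 ≤ X.dim) (hY1 : 1 ≤ Y.dim)
    (s : lefschetzGroup X.dim X.X) (t : lefschetzGroup Y.dim Y.X) (hs : s.1 ∈ specialLefschetzGroup X.dim X.X)
    (ht : t.1 ∈ specialLefschetzGroup Y.dim Y.X) :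
    ∃ g : lefschetzGroup (X.prod Y).dim (X.prod Y).X,
      g.1 ∈ specialLefschetzGroup (X.prod Y).dim (X.prod Y).X ∧ ρ g = (s, t) := by
  have hmem := (prodBlockDiagEquiv_mem_map_specialLefschetzGroup_one_prod_iff X Y hXY hYX hX1 hY1 (s.1 1) (t.1 1)).2
    ⟨⟨s.1, hs, rfl⟩, ⟨t.1, ht, rfl⟩⟩
  obtain ⟨g, hg, hg1⟩ := hmem
  have hg1' : g 1 = prodBlockDiagEquiv (s.1 1) (t.1 1) := hg1
  refine ⟨⟨g, specialLefschetzGroup_le_lefschetzGroup hg⟩, hg, ?_⟩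
  have key := hρ ⟨g, specialLefschetzGroup_le_lefschetzGroup hg⟩
  rw [show (⟨g, specialLefschetzGroup_le_lefschetzGroup hg⟩ : lefschetzGroup (X.prod Y).dim (X.prod Y).X).1 1 = g 1
    from rfl, hg1'] at key
  obtain ⟨e1, e2⟩ := prodBlockDiagEquiv_inj key
  exact Prod.ext (Subtype.ext (lefschetzGroup_ext_one' (ρ _).1.2 s.2 e1.symm))
    (Subtype.ext (lefschetzGroup_ext_one' (ρ _).2.2 t.2 e2.symm))

/-- **The image of `ρ` is Milne's fibre product `(L(X), l) ×_{𝔾_m} (L(Y), l)`, class-free** (`Hom(X, Y) = 0 = Hom(Y, X)`):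
`(a, b) = ρ(g)` for some `g ∈ L(X × Y)(ℂ)` iff `a = w(c)s`, `b = w(c)t` with ONE AND THE SAME `c ∈ ℂˣ` and `s ∈ ker l(X)`,
`t ∈ ker l(Y)` — «the largest subgroup of `∏ Gᵢ` on which the characters agree» (`L = w(𝔾_m) · ker l`, `l(w(c)s) = c²`,
`w(-1) ∈ ker l`). [cite: Milne1999LefschetzClasses, Def. 4.6 and Cor. 4.7 (p. 660), p. 659] -/
theorem mem_range_lefschetzGroup_prod_restrictHom_iff
    (hρ : ∀ g : lefschetzGroup (X.prod Y).dim (X.prod Y).X, g.1 1 = prodBlockDiagEquiv ((ρ g).1.1 1) ((ρ g).2.1 1))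
    (hXY : ∀ f : X ⟶ Y, f = 0) (hYX : ∀ f : Y ⟶ X, f = 0) (hX1 : 1 ≤ X.dim) (hY1 : 1 ≤ Y.dim)
    (ab : lefschetzGroup X.dim X.X × lefschetzGroup Y.dim Y.X) :
    ab ∈ Set.range ρ ↔ ∃ (c : ℂˣ) (s : ∀ k : ℕ, complexBetti X.X k ≃ₗ[ℂ] complexBetti X.X k)
      (t : ∀ k : ℕ, complexBetti Y.X k ≃ₗ[ℂ] complexBetti Y.X k), s ∈ specialLefschetzGroup X.dim X.X ∧
        t ∈ specialLefschetzGroup Y.dim Y.X ∧ ab.1.1 = weightCocharacter X.X c * s ∧ ab.2.1 = weightCocharacter Y.X c * t := by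
  constructor
  · rintro ⟨g, rfl⟩
    obtain ⟨c, s, hs, hgs⟩ := mem_lefschetzGroup_iff_exists_weightCocharacter_mul.1 g.2
    have hg : g = ⟨weightCocharacter (X.prod Y).X c, weightCocharacter_mem_lefschetzGroup c⟩ *
        ⟨s, specialLefschetzGroup_le_lefschetzGroup hs⟩ := Subtype.ext hgs
    have hρs := lefschetzGroup_prod_restrictHom_mem_specialLefschetzGroup hρ hX1 hY1
      (g := ⟨s, specialLefschetzGroup_le_lefschetzGroup hs⟩) hs
    refine ⟨c, _, _, hρs.1, hρs.2, ?_, ?_⟩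
    · rw [hg, map_mul, lefschetzGroup_prod_restrictHom_weightCocharacter hρ, Prod.fst_mul, Subgroup.coe_mul]
    · rw [hg, map_mul, lefschetzGroup_prod_restrictHom_weightCocharacter hρ, Prod.snd_mul, Subgroup.coe_mul]
  · rintro ⟨c, s, t, hs, ht, ha, hb⟩
    obtain ⟨g, -, hg⟩ := exists_specialLefschetzGroup_restrictHom_eq hρ hXY hYX hX1 hY1
      ⟨s, specialLefschetzGroup_le_lefschetzGroup hs⟩ ⟨t, specialLefschetzGroup_le_lefschetzGroup ht⟩ hs ht
    refine ⟨⟨weightCocharacter (X.prod Y).X c, weightCocharacter_mem_lefschetzGroup c⟩ * g, ?_⟩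
    rw [map_mul, lefschetzGroup_prod_restrictHom_weightCocharacter hρ, hg]
    exact Prod.ext (Subtype.ext (by rw [ha]; rfl)) (Subtype.ext (by rw [hb]; rfl))

/-- **The image of `ρ` in terms of polarization classes**: `(a, b) = ρ(g)` for some `g` iff `a₁` and `b₁` multiply `Q_{h_X}`,
`Q_{h_Y}` by one and the same unit (`h_X`, `h_Y` any polarization classes; `Hom(X, Y) = 0 = Hom(Y, X)`).
[cite: Milne1999LefschetzClasses, Def. 4.6 and Cor. 4.7 (p. 660)] -/
theorem mem_range_lefschetzGroup_prod_restrictHom_iff_exists_multiplier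
    (hρ : ∀ g : lefschetzGroup (X.prod Y).dim (X.prod Y).X, g.1 1 = prodBlockDiagEquiv ((ρ g).1.1 1) ((ρ g).2.1 1))
    (hXY : ∀ f : X ⟶ Y, f = 0) (hYX : ∀ f : Y ⟶ X, f = 0) (hX1 : 1 ≤ X.dim) (hY1 : 1 ≤ Y.dim)
    {hX : complexBetti X.X 2} {hY : complexBetti Y.X 2} (hpolX : IsPolarizationClass X.dim X.X hX)
    (hpolY : IsPolarizationClass Y.dim Y.X hY) (ab : lefschetzGroup X.dim X.X × lefschetzGroup Y.dim Y.X) :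
    ab ∈ Set.range ρ ↔ ∃ c : ℂˣ,
      (∀ a a' : complexBetti X.X 1, polarizationPairingOne X.X hX (X.dim - 1) (ab.1.1 1 a) (ab.1.1 1 a') =
        (c : ℂ) • polarizationPairingOne X.X hX (X.dim - 1) a a') ∧
      ∀ b b' : complexBetti Y.X 1, polarizationPairingOne Y.X hY (Y.dim - 1) (ab.2.1 1 b) (ab.2.1 1 b') =
        (c : ℂ) • polarizationPairingOne Y.X hY (Y.dim - 1) b b' := by
  rw [mem_range_lefschetzGroup_prod_restrictHom_iff hρ hXY hYX hX1 hY1]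
  constructor
  · rintro ⟨c, s, t, hs, ht, ha, hb⟩
    refine ⟨c ^ 2, fun a a' ↦ ?_, fun b b' ↦ ?_⟩
    · rw [ha]
      exact polarizationPairingOne_weightCocharacter_mul hX c ((hpolX.mem_specialLefschetzGroup_iff_mem_lefschetzGroup hX1).1 hs).2 a a'
    · rw [hb]
      exact polarizationPairingOne_weightCocharacter_mul hY c ((hpolY.mem_specialLefschetzGroup_iff_mem_lefschetzGroup hY1).1 ht).2 b b'
  · rintro ⟨c, hca, hcb⟩
    obtain ⟨c₁, s, hs, has⟩ := mem_lefschetzGroup_iff_exists_weightCocharacter_mul.1 ab.1.2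
    obtain ⟨c₂, t, ht, hbt⟩ := mem_lefschetzGroup_iff_exists_weightCocharacter_mul.1 ab.2.2
    have e1 := polarizationPairingOne_weightCocharacter_mul hX c₁ ((hpolX.mem_specialLefschetzGroup_iff_mem_lefschetzGroup hX1).1 hs).2
    have e2 := polarizationPairingOne_weightCocharacter_mul hY c₂ ((hpolY.mem_specialLefschetzGroup_iff_mem_lefschetzGroup hY1).1 ht).2
    rw [← has] at e1
    rw [← hbt] at e2
    have h1 : c = c₁ ^ 2 := multiplier_unique hca e1 (hpolX.exists_polarizationPairingOne_ne_zero hX1)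
    have h2 : c = c₂ ^ 2 := multiplier_unique hcb e2 (hpolY.exists_polarizationPairingOne_ne_zero hY1)
    -- `c₁² = c₂²`: `c₂ = ± c₁`, and `w(-1) ∈ ker l(Y)`
    have h12 : c₂ = c₁ ∨ c₂ = -c₁ := by
      have hsq : (c₂ : ℂ) ^ 2 = (c₁ : ℂ) ^ 2 := by
        have := congrArg Units.val (h2.symm.trans h1)
        simpa only [Units.val_pow_eq_pow_val] using this
      rcases sq_eq_sq_iff_eq_or_eq_neg.1 hsq with h | h
      · exact Or.inl (Units.ext h)
      · exact Or.inr (Units.ext (by rw [h, Units.val_neg]))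
    rcases h12 with h12 | h12 <;> rw [h12] at hbt
    · exact ⟨c₁, s, t, hs, ht, has, hbt⟩
    · refine ⟨c₁, s, weightCocharacter Y.X (-1) * t, hs, (specialLefschetzGroup _ _).mul_mem
        ((weightCocharacter_mem_specialLefschetzGroup_iff (AbelianVariety.isSmoothProjective_holds (A := Y)) hY1).2
          (by simp)) ht, has, ?_⟩
      rw [hbt, ← mul_assoc, ← weightCocharacter_mul, mul_neg_one]

end HomOrthogonal

/-! ### §4 Torus coordinates with character multiply -/

section Coordinates

/-- **TORUS COORDINATES WITH CHARACTER MULTIPLY** (`Hom(X, Y) = 0 = Hom(Y, X)`, `dim X, dim Y ≥ 1`): given group isomorphisms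
`e_X : L(X)(ℂ) ≃* T_X × ℂˣ`, `e_Y : L(Y)(ℂ) ≃* T_Y × ℂˣ` whose LAST COORDINATE IS THE CHARACTER (`= 1` on `ker l`, `= c²` at
`w(c)`; e.g. the CM coordinates of `Milne1999/LefschetzGroupCMProducts`), there is `e : L(X × Y)(ℂ) ≃* (T_X × T_Y) × ℂˣ` with
the same two properties, reading the `T`-coordinates and the character through the restriction `ρ`:
`e(g) = ((e_X(ρ(g)₁)₁, e_Y(ρ(g)₂)₁), e_X(ρ(g)₁)₂)` and `e_X(ρ(g)₁)₂ = e_Y(ρ(g)₂)₂` — Cor. 4.7 «`(L(A), l(A)) ≅ ∏ (L(Aᵢ), l(Aᵢ))`»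
with the fibre product `T_X × T_Y × 𝔾_m` of `(T_X × 𝔾_m, pr₂)` and `(T_Y × 𝔾_m, pr₂)`; the induction step of Milne 1999b
Thm. 2.6 `(T^K, t^K) = ∏_Ψ (T^Ψ, t^Ψ)`. [cite: Milne1999LefschetzClasses, Def. 4.6 and Cor. 4.7 (p. 660)] [cite: Milne1999, §2 Thm. 2.6] -/
theorem exists_lefschetzGroup_prod_mulEquiv_of_mulEquiv {TX TY : Type*} [Group TX] [Group TY]
    (hXY : ∀ f : X ⟶ Y, f = 0) (hYX : ∀ f : Y ⟶ X, f = 0) (hX1 : 1 ≤ X.dim) (hY1 : 1 ≤ Y.dim)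
    (eX : lefschetzGroup X.dim X.X ≃* TX × ℂˣ) (eY : lefschetzGroup Y.dim Y.X ≃* TY × ℂˣ)
    (heX1 : ∀ s : lefschetzGroup X.dim X.X, s.1 ∈ specialLefschetzGroup X.dim X.X → (eX s).2 = 1)
    (heX2 : ∀ c : ℂˣ, (eX ⟨weightCocharacter X.X c, weightCocharacter_mem_lefschetzGroup c⟩).2 = c ^ 2)
    (heY1 : ∀ t : lefschetzGroup Y.dim Y.X, t.1 ∈ specialLefschetzGroup Y.dim Y.X → (eY t).2 = 1)
    (heY2 : ∀ c : ℂˣ, (eY ⟨weightCocharacter Y.X c, weightCocharacter_mem_lefschetzGroup c⟩).2 = c ^ 2)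
    {ρ : lefschetzGroup (X.prod Y).dim (X.prod Y).X →* lefschetzGroup X.dim X.X × lefschetzGroup Y.dim Y.X}
    (hρ : ∀ g : lefschetzGroup (X.prod Y).dim (X.prod Y).X, g.1 1 = prodBlockDiagEquiv ((ρ g).1.1 1) ((ρ g).2.1 1)) :
    ∃ e : lefschetzGroup (X.prod Y).dim (X.prod Y).X ≃* (TX × TY) × ℂˣ,
      (∀ g : lefschetzGroup (X.prod Y).dim (X.prod Y).X,
        g.1 ∈ specialLefschetzGroup (X.prod Y).dim (X.prod Y).X → (e g).2 = 1) ∧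
      (∀ c : ℂˣ, (e ⟨weightCocharacter (X.prod Y).X c, weightCocharacter_mem_lefschetzGroup c⟩).2 = c ^ 2) ∧
      (∀ g : lefschetzGroup (X.prod Y).dim (X.prod Y).X, e g = (((eX (ρ g).1).1, (eY (ρ g).2).1), (eX (ρ g).1).2)) ∧
      ∀ g : lefschetzGroup (X.prod Y).dim (X.prod Y).X, (eX (ρ g).1).2 = (eY (ρ g).2).2 := by
  classical
  -- the character coordinate of `a ∈ L(X)`: `a = w(c)s ⟹ (e_X a).2 = c²`
  have hcharX : ∀ (c : ℂˣ) (s : ∀ k : ℕ, complexBetti X.X k ≃ₗ[ℂ] complexBetti X.X k)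
      (hs : s ∈ specialLefschetzGroup X.dim X.X),
      (eX ⟨weightCocharacter X.X c * s, (lefschetzGroup _ _).mul_mem (weightCocharacter_mem_lefschetzGroup c)
        (specialLefschetzGroup_le_lefschetzGroup hs)⟩).2 = c ^ 2 := fun c s hs ↦ by
    rw [show (⟨weightCocharacter X.X c * s, _⟩ : lefschetzGroup X.dim X.X) =
        ⟨weightCocharacter X.X c, weightCocharacter_mem_lefschetzGroup c⟩ * ⟨s, specialLefschetzGroup_le_lefschetzGroup hs⟩
        from rfl, map_mul, Prod.snd_mul, heX2, heX1 _ hs, mul_one]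
  have hcharY : ∀ (c : ℂˣ) (t : ∀ k : ℕ, complexBetti Y.X k ≃ₗ[ℂ] complexBetti Y.X k)
      (ht : t ∈ specialLefschetzGroup Y.dim Y.X),
      (eY ⟨weightCocharacter Y.X c * t, (lefschetzGroup _ _).mul_mem (weightCocharacter_mem_lefschetzGroup c)
        (specialLefschetzGroup_le_lefschetzGroup ht)⟩).2 = c ^ 2 := fun c t ht ↦ by
    rw [show (⟨weightCocharacter Y.X c * t, _⟩ : lefschetzGroup Y.dim Y.X) =
        ⟨weightCocharacter Y.X c, weightCocharacter_mem_lefschetzGroup c⟩ * ⟨t, specialLefschetzGroup_le_lefschetzGroup ht⟩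
        from rfl, map_mul, Prod.snd_mul, heY2, heY1 _ ht, mul_one]
  -- `(e_X a).2 = (e_Y b).2 ⟺ (a, b) ∈ im ρ`
  have hrange : ∀ ab : lefschetzGroup X.dim X.X × lefschetzGroup Y.dim Y.X,
      ab ∈ Set.range ρ ↔ (eX ab.1).2 = (eY ab.2).2 := fun ab ↦ by
    rw [mem_range_lefschetzGroup_prod_restrictHom_iff hρ hXY hYX hX1 hY1]
    constructor
    · rintro ⟨c, s, t, hs, ht, ha, hb⟩
      have ea : ab.1 = ⟨weightCocharacter X.X c * s, (lefschetzGroup _ _).mul_mem (weightCocharacter_mem_lefschetzGroup c)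
          (specialLefschetzGroup_le_lefschetzGroup hs)⟩ := Subtype.ext ha
      have eb : ab.2 = ⟨weightCocharacter Y.X c * t, (lefschetzGroup _ _).mul_mem (weightCocharacter_mem_lefschetzGroup c)
          (specialLefschetzGroup_le_lefschetzGroup ht)⟩ := Subtype.ext hb
      rw [ea, eb, hcharX c s hs, hcharY c t ht]
    · intro heq
      obtain ⟨c₁, s, hs, has⟩ := mem_lefschetzGroup_iff_exists_weightCocharacter_mul.1 ab.1.2
      obtain ⟨c₂, t, ht, hbt⟩ := mem_lefschetzGroup_iff_exists_weightCocharacter_mul.1 ab.2.2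
      have ea : ab.1 = ⟨weightCocharacter X.X c₁ * s, (lefschetzGroup _ _).mul_mem (weightCocharacter_mem_lefschetzGroup c₁)
          (specialLefschetzGroup_le_lefschetzGroup hs)⟩ := Subtype.ext has
      have eb : ab.2 = ⟨weightCocharacter Y.X c₂ * t, (lefschetzGroup _ _).mul_mem (weightCocharacter_mem_lefschetzGroup c₂)
          (specialLefschetzGroup_le_lefschetzGroup ht)⟩ := Subtype.ext hbt
      rw [ea, eb, hcharX c₁ s hs, hcharY c₂ t ht] at heq
      have h12 : c₂ = c₁ ∨ c₂ = -c₁ := by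
        rcases sq_eq_sq_iff_eq_or_eq_neg.1 (by
            have := congrArg Units.val heq.symm
            simpa only [Units.val_pow_eq_pow_val] using this : (c₂ : ℂ) ^ 2 = (c₁ : ℂ) ^ 2) with h | h
        · exact Or.inl (Units.ext h)
        · exact Or.inr (Units.ext (by rw [h, Units.val_neg]))
      rcases h12 with h12 | h12 <;> rw [h12] at hbt
      · exact ⟨c₁, s, t, hs, ht, has, hbt⟩
      · refine ⟨c₁, s, weightCocharacter Y.X (-1) * t, hs, (specialLefschetzGroup _ _).mul_mem
          ((weightCocharacter_mem_specialLefschetzGroup_iff (AbelianVariety.isSmoothProjective_holds (A := Y)) hY1).2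
            (by simp)) ht, has, ?_⟩
        rw [hbt, ← mul_assoc, ← weightCocharacter_mul, mul_neg_one]
  -- the coordinate map `(a, b) ↦ ((e_X a)₁, (e_Y b)₁, (e_X a)₂)` on `L(X) × L(Y)` and its composite with `ρ`
  let κ : lefschetzGroup X.dim X.X × lefschetzGroup Y.dim Y.X →* (TX × TY) × ℂˣ :=
    (((MonoidHom.fst TX ℂˣ).comp (eX.toMonoidHom.comp (MonoidHom.fst _ _))).prod
      ((MonoidHom.fst TY ℂˣ).comp (eY.toMonoidHom.comp (MonoidHom.snd _ _)))).prod
      ((MonoidHom.snd TX ℂˣ).comp (eX.toMonoidHom.comp (MonoidHom.fst _ _)))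
  have hκ : ∀ ab, κ ab = (((eX ab.1).1, (eY ab.2).1), (eX ab.1).2) := fun _ ↦ rfl
  let F := κ.comp ρ
  have hF : ∀ g, F g = (((eX (ρ g).1).1, (eY (ρ g).2).1), (eX (ρ g).1).2) := fun _ ↦ rfl
  have hinj : Function.Injective F := fun g g' h ↦ by
    rw [hF, hF, Prod.mk.injEq, Prod.mk.injEq] at h
    obtain ⟨⟨h1, h2⟩, h3⟩ := h
    have hg := (hrange (ρ g)).1 ⟨g, rfl⟩
    have hg' := (hrange (ρ g')).1 ⟨g', rfl⟩
    refine lefschetzGroup_prod_restrictHom_injective hρ (Prod.ext (eX.injective (Prod.ext h1 h3))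
      (eY.injective (Prod.ext h2 ?_)))
    rw [← hg, ← hg', h3]
  have hsurj : Function.Surjective F := fun ttc ↦ by
    obtain ⟨⟨tX, tY⟩, c⟩ := ttc
    have hab : (eX.symm (tX, c), eY.symm (tY, c)) ∈ Set.range ρ := by
      rw [hrange]
      simp only [MulEquiv.apply_symm_apply]
    obtain ⟨g, hg⟩ := hab
    refine ⟨g, ?_⟩
    rw [hF, hg]
    simp only [MulEquiv.apply_symm_apply]
  refine ⟨MulEquiv.ofBijective F ⟨hinj, hsurj⟩, fun g hg ↦ ?_, fun c ↦ ?_, fun g ↦ hF g, fun g ↦ (hrange (ρ g)).1 ⟨g, rfl⟩⟩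
  · show (F g).2 = 1
    rw [hF]
    exact heX1 _ (lefschetzGroup_prod_restrictHom_mem_specialLefschetzGroup hρ hX1 hY1 hg).1
  · show (F _).2 = c ^ 2
    rw [hF]
    show (eX (ρ ⟨weightCocharacter (X.prod Y).X c, weightCocharacter_mem_lefschetzGroup c⟩).1).2 = c ^ 2
    rw [lefschetzGroup_prod_restrictHom_weightCocharacter hρ, heX2]

/-- **`L(X × Y)(ℂ) ≃* (T_X × T_Y) × ℂˣ` with the character as last coordinate**, hypothesis-free in `ρ` (the restriction
homomorphism exists, §2): torus coordinates with character for Hom-orthogonal `X`, `Y` of positive dimension multiply.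
[cite: Milne1999LefschetzClasses, Def. 4.6 and Cor. 4.7 (p. 660)] [cite: Milne1999, §2 Thm. 2.6] -/
theorem exists_lefschetzGroup_prod_mulEquiv_of_mulEquiv' {TX TY : Type*} [Group TX] [Group TY]
    (hXY : ∀ f : X ⟶ Y, f = 0) (hYX : ∀ f : Y ⟶ X, f = 0) (hX1 : 1 ≤ X.dim) (hY1 : 1 ≤ Y.dim)
    (eX : lefschetzGroup X.dim X.X ≃* TX × ℂˣ) (eY : lefschetzGroup Y.dim Y.X ≃* TY × ℂˣ)
    (heX1 : ∀ s : lefschetzGroup X.dim X.X, s.1 ∈ specialLefschetzGroup X.dim X.X → (eX s).2 = 1)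
    (heX2 : ∀ c : ℂˣ, (eX ⟨weightCocharacter X.X c, weightCocharacter_mem_lefschetzGroup c⟩).2 = c ^ 2)
    (heY1 : ∀ t : lefschetzGroup Y.dim Y.X, t.1 ∈ specialLefschetzGroup Y.dim Y.X → (eY t).2 = 1)
    (heY2 : ∀ c : ℂˣ, (eY ⟨weightCocharacter Y.X c, weightCocharacter_mem_lefschetzGroup c⟩).2 = c ^ 2) :
    ∃ e : lefschetzGroup (X.prod Y).dim (X.prod Y).X ≃* (TX × TY) × ℂˣ,
      (∀ g : lefschetzGroup (X.prod Y).dim (X.prod Y).X,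
        g.1 ∈ specialLefschetzGroup (X.prod Y).dim (X.prod Y).X → (e g).2 = 1) ∧
      ∀ c : ℂˣ, (e ⟨weightCocharacter (X.prod Y).X c, weightCocharacter_mem_lefschetzGroup c⟩).2 = c ^ 2 := by
  obtain ⟨ρ, hρ⟩ := exists_lefschetzGroup_prod_restrictHom (X := X) (Y := Y) hX1 hY1
  obtain ⟨e, h1, h2, -, -⟩ := exists_lefschetzGroup_prod_mulEquiv_of_mulEquiv hXY hYX hX1 hY1 eX eY heX1 heX2 heY1 heY2 hρ
  exact ⟨e, h1, h2⟩

/-- **Under torus coordinates with character, `ker l` is exactly `{last coordinate = 1}`** (`dim Z ≥ 1`): the hypothesis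
«`= 1` on `ker l`, `= c²` at `w(c)`» pins the last coordinate to Milne's `l`, whose kernel is `ker l(Z)` — `g = w(c)s` has
last coordinate `c²`, and `w(c) ∈ ker l ⟺ c² = 1`. [cite: Milne1999LefschetzClasses, §4 p. 659 (ker l = S(A), l ∘ w = -2)] -/
theorem snd_eq_one_iff_mem_specialLefschetzGroup_of_mulEquiv {T : Type*} [Group T] (hZ : 1 ≤ Z.dim)
    (eZ : lefschetzGroup Z.dim Z.X ≃* T × ℂˣ)
    (he1 : ∀ s : lefschetzGroup Z.dim Z.X, s.1 ∈ specialLefschetzGroup Z.dim Z.X → (eZ s).2 = 1)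
    (he2 : ∀ c : ℂˣ, (eZ ⟨weightCocharacter Z.X c, weightCocharacter_mem_lefschetzGroup c⟩).2 = c ^ 2)
    (g : lefschetzGroup Z.dim Z.X) : (eZ g).2 = 1 ↔ g.1 ∈ specialLefschetzGroup Z.dim Z.X := by
  refine ⟨fun h ↦ ?_, he1 g⟩
  obtain ⟨c, s, hs, hgs⟩ := mem_lefschetzGroup_iff_exists_weightCocharacter_mul.1 g.2
  have hg : g = ⟨weightCocharacter Z.X c, weightCocharacter_mem_lefschetzGroup c⟩ *
      ⟨s, specialLefschetzGroup_le_lefschetzGroup hs⟩ := Subtype.ext hgs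
  rw [hg, map_mul, Prod.snd_mul, he2, he1 _ hs, mul_one] at h
  have hc : (c : ℂ) ^ 2 = 1 := by rw [← Units.val_pow_eq_pow_val, h, Units.val_one]
  rw [hgs]
  exact (specialLefschetzGroup _ _).mul_mem
    ((weightCocharacter_mem_specialLefschetzGroup_iff (AbelianVariety.isSmoothProjective_holds (A := Z)) hZ).2 hc) hs

/-- **Under torus coordinates with character, the last coordinate is the multiplier on `H¹` for every polarization class**
(`dim Z ≥ 1`): `Q_h(g₁x, g₁y) = e(g)₂ · Q_h(x, y)`. [cite: Milne1999LefschetzClasses, Def. 4.3, Thm. 4.4 and §4 p. 659] -/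
theorem polarizationPairingOne_eq_snd_smul_of_mulEquiv {T : Type*} [Group T] (hZ : 1 ≤ Z.dim)
    (eZ : lefschetzGroup Z.dim Z.X ≃* T × ℂˣ)
    (he1 : ∀ s : lefschetzGroup Z.dim Z.X, s.1 ∈ specialLefschetzGroup Z.dim Z.X → (eZ s).2 = 1)
    (he2 : ∀ c : ℂˣ, (eZ ⟨weightCocharacter Z.X c, weightCocharacter_mem_lefschetzGroup c⟩).2 = c ^ 2)
    {h : complexBetti Z.X 2} (hpol : IsPolarizationClass Z.dim Z.X h) (g : lefschetzGroup Z.dim Z.X)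
    (x y : complexBetti Z.X 1) :
    polarizationPairingOne Z.X h (Z.dim - 1) (g.1 1 x) (g.1 1 y) =
      (((eZ g).2 : ℂˣ) : ℂ) • polarizationPairingOne Z.X h (Z.dim - 1) x y := by
  obtain ⟨c, s, hs, hgs⟩ := mem_lefschetzGroup_iff_exists_weightCocharacter_mul.1 g.2
  have hg : g = ⟨weightCocharacter Z.X c, weightCocharacter_mem_lefschetzGroup c⟩ *
      ⟨s, specialLefschetzGroup_le_lefschetzGroup hs⟩ := Subtype.ext hgs
  have e2 : (eZ g).2 = c ^ 2 := by rw [hg, map_mul, Prod.snd_mul, he2, he1 _ hs, mul_one]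
  rw [e2, hgs]
  exact polarizationPairingOne_weightCocharacter_mul h c ((hpol.mem_specialLefschetzGroup_iff_mem_lefschetzGroup hZ).1 hs).2 x y

end Coordinates

end Literature.AlgebraicGeometry.Milne1999

end
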